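import Mathlib

/-!
# Sketch — crux-ideate `stmt-HodgeConjecture-13674` (TwinSimilitudeAlgebraic), round 2, ideator 4

First lemmas of the two crux idea cards of this seat, as linear algebra over `ℚ` (they elaborate and
are proved; the geometric statements instantiate them with `V = H²(−;ℚ)` and the cup forms).

* Card `hecke-pair-galois-twins`: `isotypic_forms_proportional` (on an isotypic component
  `W ⊗ M` with invariant form `B_W ⊗ B_M`, the forms induced on the lines `w₁ ⊗ M`, `w₂ ⊗ M` are
  proportional with ratio `B_W(w₂,w₂) : B_W(w₁,w₁)`), and the `A₄` identities `a4_average_iota`,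
  `a4_average_rho`, `a4_norms` behind the multiplier `λ(ℤ/3, ℤ/2) = 3·4/(2·12) = 1/2`.
* Card `hyperkaehler-nikulin-anchors`: `twin_of_restriction_chain` (an isometry followed by a
  restriction map that doubles the form is a 2-similitude) and `restriction_injective_of_anisotropic`.
-/

namespace Summit.HodgeConjecture.HodgeConjecture.Cruxes.TwinSimilitudeAlgebraic.IdeaSketch4

open scoped TensorProduct
open LinearMap (BilinForm)

variable {W M V₁ V₂ V₃ : Type*} [AddCommGroup W] [Module ℚ W] [AddCommGroup M] [Module ℚ M]
  [AddCommGroup V₁] [Module ℚ V₁] [AddCommGroup V₂] [Module ℚ V₂] [AddCommGroup V₃] [Module ℚ V₃]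

/-- **Card 1, first lemma (Hecke-pair multiplier).** On an isotypic component `W ⊗ M` carrying the
invariant form `B_W ⊗ B_M`, the forms restricted to the two lines `w₁ ⊗ M` and `w₂ ⊗ M` (the
`H₁`- and `H₂`-invariants) are proportional: `B_W(w₁,w₁) · ⟨w₂⊗m, w₂⊗m'⟩ = B_W(w₂,w₂) · ⟨w₁⊗m, w₁⊗m'⟩`.
With the degree normalisations `|H₁|, |H₂|` of the two quotient maps this is the multiplier formula
`λ(H₁,H₂) = (B_W(w₂,w₂)/|H₂|) / (B_W(w₁,w₁)/|H₁|)` of the card. -/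
theorem isotypic_forms_proportional (BW : BilinForm ℚ W) (BM : BilinForm ℚ M) (w₁ w₂ : W)
    (m m' : M) :
    BW w₁ w₁ * (BW.tmul BM) (w₂ ⊗ₜ m) (w₂ ⊗ₜ m') = BW w₂ w₂ * (BW.tmul BM) (w₁ ⊗ₜ m) (w₁ ⊗ₜ m') := by
  simp only [LinearMap.BilinForm.tmul, LinearMap.BilinForm.tensorDistrib_tmul]
  ring

/-- The `A₄`-data of the minimal Hecke twin pair, in the permutation module `ℤ⁴ ⊃ W₃ = {Σ xᵢ = 0}`:
`w₁` spans the `ℤ/3 = ⟨(123)⟩`-invariants, `w₂` the `ℤ/2 = ⟨(12)(34)⟩`-invariants. -/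
abbrev w₁ : Fin 4 → ℤ := ![1, 1, 1, -3]
/-- see `w₁` -/
abbrev w₂ : Fin 4 → ℤ := ![1, 1, -1, -1]
/-- the double transposition `(12)(34)` as an index map -/
abbrev ι : Fin 4 → Fin 4 := ![1, 0, 3, 2]
/-- the 3-cycle `(123)` as an index map -/
abbrev ρ : Fin 4 → Fin 4 := ![1, 2, 0, 3]

/-- `w₁ + ι·w₁ = 2 w₂`: the Hecke operator `π₂₊π₁^*` sends the `ℤ/3`-invariant line onto the
`ℤ/2`-invariant line with coefficient 2 (non-zero!). -/
theorem a4_average_iota : w₁ + w₁ ∘ ι = (2 : ℤ) • w₂ := by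
  decide

/-- `w₂ + ρ·w₂ + ρ²·w₂ = w₁`: averaging the `ℤ/2`-line over `ℤ/3` returns the `ℤ/3`-line, so the
composite correspondence acts on `T(X₁)` as multiplication by `2`. -/
theorem a4_average_rho : w₂ + w₂ ∘ ρ + w₂ ∘ ρ ∘ ρ = w₁ := by
  decide

/-- The norms `B(w₁,w₁) = 12`, `B(w₂,w₂) = 4` for the standard (permutation) form; hence
`λ(ℤ/3,ℤ/2) = (4/2)/(12/3) = 1/2`: the two K3 quotients are TWINS. -/
theorem a4_norms : (∑ i, w₁ i * w₁ i) = 12 ∧ (∑ i, w₂ i * w₂ i) = 4 ∧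
    ((4 : ℚ) / 2) / (12 / 3) = 1 / 2 := by
  refine ⟨by decide, by decide, by norm_num⟩

/-- **Card 2, first lemma (restriction chain).** If `φ : V₁ → V₂` is an isometry (Markman's
algebraic rational Hodge isometry `H²(S^[2]) → H²(X)`) and `r : V₂ → V₃` doubles the form
(restriction to the fixed K3 surface `Σ` of a symplectic involution, `∫_Σ x|·y| = 2 q(x,y)` on
`T(X)`), then `r ∘ φ` is a 2-similitude — the shape of hypothesis `hsim` of the crux for the pair
`(Σ, S)`. -/
theorem twin_of_restriction_chain (B₁ : BilinForm ℚ V₁) (B₂ : BilinForm ℚ V₂) (B₃ : BilinForm ℚ V₃)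
    (φ : V₁ →ₗ[ℚ] V₂) (r : V₂ →ₗ[ℚ] V₃) (hφ : ∀ x y, B₂ (φ x) (φ y) = B₁ x y)
    (hr : ∀ u v, B₃ (r u) (r v) = 2 * B₂ u v) (x y : V₁) :
    B₃ ((r ∘ₗ φ) x) ((r ∘ₗ φ) y) = 2 * B₁ x y := by
  simp [hr, hφ]

/-- A form-doubling map is injective on any subspace where the source form is anisotropic (used
with `V₂ = T(X)_ℝ`-positive part / irreducibility of `T(X)`: the restriction to `Σ` is injective
on `T(X)`, as in Mongardi's proof of his Thm 4.1). -/
theorem restriction_injective_of_anisotropic (B₂ : BilinForm ℚ V₂) (B₃ : BilinForm ℚ V₃)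
    (r : V₂ →ₗ[ℚ] V₃) (hr : ∀ u v, B₃ (r u) (r v) = 2 * B₂ u v)
    (han : ∀ u, B₂ u u = 0 → u = 0) : Function.Injective r := by
  intro u v h
  have hz : r (u - v) = 0 := by rw [map_sub, h, sub_self]
  have h0 : B₂ (u - v) (u - v) = 0 := by
    have := hr (u - v) (u - v)
    rw [hz, map_zero] at this
    first
      | (simp only [LinearMap.zero_apply] at this; linarith)
      | linarith
  exact sub_eq_zero.mp (han _ h0)

end Summit.HodgeConjecture.HodgeConjecture.Cruxes.TwinSimilitudeAlgebraic.IdeaSketch4
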